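import Mathlib
import Literature.Analysis.FluidPDE.ChaeTypeIIProfileSteadyLimit
import Literature.Analysis.FluidPDE.SteadyNSLiouville
import Literature.Analysis.FluidPDE.SteadyNSSolution
import Literature.Analysis.FluidPDE.SteadyDSolutionAsymptotics
import Literature.Analysis.FluidPDE.VorticityDoubleConeRegularity
import Literature.Analysis.FluidPDE.ConstantinFeffermanHolds
import Literature.Analysis.FluidPDE.GrujicRuzmaikina2004HybridDirectionCriterionHolds
import Literature.Analysis.FluidPDE.GrujicZhang2006LocalizedHybridCoherenceHolds
import Literature.Analysis.FluidPDE.GrujicZhang2006LocalizedIntegralCoherenceHolds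
import Literature.Analysis.FluidPDE.GrujicLocalizedCoherenceHolds
import Literature.Analysis.FluidPDE.GrujicGuberovic2010CoherenceWeightedCriterionHolds
import Literature.Analysis.FluidPDE.GradientRegularityCriteriaProofs
import Literature.Analysis.FluidPDE.OneDirectionDerivativeCriterionProofs
import Literature.Analysis.FluidPDE.OneComponentGradientCriterionProofs
import Literature.Analysis.FluidPDE.PressureGradientCriterionProofs
import Literature.Analysis.FluidPDE.BeiraoDaVeigaVorticityCriterion
import Literature.Analysis.FluidPDE.NSCriticalClosureBesovHolds
import Literature.Analysis.FluidPDE.NSCriticalClosureHolds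
import HarnessLib.Audit
import HarnessLib

/-!
# Blow-up scenario census — block F annex: row F4b′ (Type-II asymptotically self-similar blow-up,
# `L^p` profile, `p > 9/2`) and its steady-Liouville bridge

Fifth file of block F of the cell `pub/ns-census` census (`SCENARIO-CENSUS.md` v1.8, seat
ns-census-lead g2; keys fixed there), route-independent (Literature imports only).

**The cell.** Row F4b′ = forward · Type II · no symmetry · Kato class `C([0,T); L^p)`, `p > 9/2`:
a POWER-LAW Type-II blow-up at `T` which is asymptotically self-similar in `L^p(ℝ³)` with profile
`V̄ ∈ L^p ∩ Ḣ¹` (Chae, J. Funct. Anal. 258 (2010), Thm 1.4 = arXiv:0711.1113 Thm 3.1, printed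
for ALL `p ∈ [3, ∞)`).  The census (v1.8, refuter finding H12 after reading the journal proof,
p. 6 l. 13) counts the cell **OPEN-NO-LINE** for `p > 9/2`: the printed proof's last sentence
"in the case `V̄ ∈ Ḣ¹ ∩ L^p` we easily obtain `∫|∇V̄|² = 0`" is the energy identity for steady
solutions in `Ḣ¹ ∩ L^p`, classical only for `p ≤ 9/2` (Galdi 2011 Thm X.9.5; tree row F4b,
`row_F4b_excluded`, `3 < p ≤ 9/2`) and equal to the OPEN Liouville problem for steady
`D`-solutions restricted to `L^p` velocities for `p > 9/2` (census row S1,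
`Literature.Analysis.FluidPDE.SteadyDSolutionLiouvilleProblem`).

**What this file types** (census §5 item 10: "have a typer state the non-thin part of the printed
proof as a cheap EXCLUDED-modulo-S1 bridge"):

* `Row_F4bp` — the cell itself (`@[conjecture]`, nothing asserted): Chae's statement verbatim the
  binders of the tree's named fact `chae2010_typeII_asymptoticallySelfSimilar`, restricted to
  `9/2 < p`.  `row_F4bp_of_chae2010` records that the (undischarged) named fact implies it.
* `Row_F4bpSteady q` — the steady Liouville statement feeding it at exponent `q`: every smooth
  steady solution of Navier–Stokes on `ℝ³` (`ν = 1`, `f = 0`) with finite Dirichlet integral and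
  `U ∈ L^q(ℝ³)` is `0` (= row S1 with the decay normalisation `U(x) → 0` replaced by `U ∈ L^q`;
  `@[conjecture]` as a family: open for `q > 9/2`, a THEOREM for `2 ≤ q ≤ 9/2`,
  `row_F4bpSteady_of_le_nineHalves`, Galdi X.9.5 in tree).
* **`row_F4bp_of_steady`** — THE BRIDGE, a theorem: `(∀ q > 9/2, Row_F4bpSteady q) → Row_F4bp`.
  Proof = the non-thin part of Chae's proof, all in tree: the profile is a very weak steady
  solution (`typeII_profile_veryWeak_steadyNS`, Chae's `ξ(s)φ(y)` test through the exact
  Navier–Stokes rescalings), it has a smooth steady representative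
  (`exists_steadyClassicalNS_ae_eq_of_veryWeak`, Kato), the weak `L²` gradient passes to the
  representative (a.e. uniqueness of weak gradients), and the hypothesis closes.
* `row_F4bpSteady_of_S1` — the census's "F4b′ ⊂ S1" made precise, CONDITIONAL on one vendored
  decay fact: `SteadyDSolutionLiouvilleProblem` (row S1) together with Galdi's Thm X.5.1 /
  Wang 2025 Rem. 2.1 (`wang2025_rem21_DSolution_tendsto_const`: a `D`-solution tends to SOME
  constant at infinity; no `_holds` in tree) gives `Row_F4bpSteady q` for every `1 ≤ q < ∞`
  (an `L^q` field tending to a constant tends to `0`).  Hence F4b′ ⇐ S1 ∧ (Galdi X.5.1).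

**Nothing in this file is a claim about Navier–Stokes regularity; no summit statement is proved
by this seat.**  `STH.` = `Summit.NavierStokesRegularity.NavierStokesRegularity.Theorems.`,
`FP.` = `Literature.Analysis.FluidPDE.`.
-/

noncomputable section

-- the summit and its single problem share the name `NavierStokesRegularity` (D-0017 nested layout)
set_option linter.dupNamespace false

open Set Function Filter Topology MeasureTheory Metric
open scoped NNReal ENNReal ContDiff

namespace Summit.NavierStokesRegularity.NavierStokesRegularity.Theorems.ScenarioCensus

open Literature.Analysis Literature.Analysis.FluidPDE

/-- Arithmetic in `ℝ≥0∞`: `3 < 9/2` (the exponent ranges of rows F4b / F4b′ meet above Kato's `p > 3`).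
[folklore] -/
theorem three_lt_nineHalves_ennreal : (3 : ℝ≥0∞) < 9 / 2 := by
  rw [ENNReal.lt_div_iff_mul_lt (Or.inl two_ne_zero) (Or.inl (by norm_num))]
  norm_num

/-! ## Row F4b′: the cell -/

/-- **Row F4b′** (Type II · asymptotically self-similar with power-law rate `γ > 1` · global `L^p`
profile, `p > 9/2` · Kato class): let `T > 0`, `p ∈ (9/2, ∞)`, `(v, π)` a classical solution of
Navier–Stokes (`ν = 1`, no force) on `ℝ³ × (0,T)` with `v ∈ C([0,T); L^p)`, `γ > 1`, and
`V̄ ∈ L^p(ℝ³)` with `(T−t)^{(p−3)γ/(2p)} ‖v(·,t) − (T−t)^{−γ/2} V̄(·/(T−t)^{γ/2})‖_{L^p} → 0` as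
`t ↑ T` (`chaeTypeIIDeviation T γ p v V̄ → 0`) and `V̄ ∈ Ḣ¹` (`eWeakGradL2Sq V̄ < ⊤`); then
`V̄ = 0` a.e.  The binders are verbatim those of the named fact
`chae2010_typeII_asymptoticallySelfSimilar` (Chae, JFA 258 (2010) Thm 1.4, printed for all
`p ≥ 3`; no `_holds`), restricted to `9/2 < p`; the range `3 < p ≤ 9/2` is row F4b
(EXCLUDED-IN-TREE, `row_F4b_excluded`).  Census value OPEN-NO-LINE since v1.8: the printed proof's
last step is the steady Liouville theorem `Row_F4bpSteady p`, open for `p > 9/2` (bridge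
`row_F4bp_of_steady`; print claim recorded by `row_F4bp_of_chae2010`).
[cite: Chae2010, Thm 1.4 (= arXiv:0711.1113 Thm 3.1), case p > 9/2] -/
@[conjecture] def Row_F4bp : Prop :=
  ∀ (T : ℝ), 0 < T → ∀ (p : ℝ≥0), (9 / 2 : ℝ≥0∞) < (p : ℝ≥0∞) →
    ∀ (v : ℝ → EuclideanSpace ℝ (Fin 3) → EuclideanSpace ℝ (Fin 3))
      (π : ℝ → EuclideanSpace ℝ (Fin 3) → ℝ),
    IsClassicalNSSolutionOn (Ioo 0 T) 1 0 v π → ContinuousInLpOn (Ico 0 T) p v →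
    ∀ (γ : ℝ), 1 < γ → ∀ (V : EuclideanSpace ℝ (Fin 3) → EuclideanSpace ℝ (Fin 3)),
    MemLp V (p : ℝ≥0∞) volume → Tendsto (chaeTypeIIDeviation T γ p v V) (𝓝[<] T) (𝓝 0) →
    eWeakGradL2Sq V < ⊤ → V =ᵐ[volume] 0

/-- The print claim: the named fact `chae2010_typeII_asymptoticallySelfSimilar` (Chae 2010
Thm 1.4 for all `p ≥ 3`, undischarged in tree) contains row F4b′. [cite: Chae2010, Thm 1.4] -/
theorem row_F4bp_of_chae2010 (h : chae2010_typeII_asymptoticallySelfSimilar) : Row_F4bp := by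
  intro T hT p hp v π hv hvc γ hγ V hV hconv hH1
  have hp3 : (3 : ℝ≥0) ≤ p := by
    have h : (3 : ℝ≥0∞) < (p : ℝ≥0∞) := lt_trans three_lt_nineHalves_ennreal hp
    exact_mod_cast h.le
  exact h hT hp3 hv hvc hγ hV hconv hH1

/-! ## The steady Liouville statement at exponent `q` (row S1 ∩ `L^q`) -/

/-- **Row F4b′, steady input at exponent `q`** (= census row S1 restricted to `L^q` velocities):
for `1 ≤ q` (`q < ∞` automatically), every SMOOTH steady solution `(U, P)` of Navier–Stokes on
`ℝ³` with `ν = 1`, `f = 0` (`IsLerayProfile 1 0 U P`: `−ΔU + (U·∇)U + ∇P = 0`, `div U = 0`) with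
finite Dirichlet integral `∫ |∇U|²_F < ∞` and `U ∈ L^q(ℝ³)` is identically `0`.  For
`2 ≤ q ≤ 9/2` a theorem (Galdi 2011 Thm X.9.5; `row_F4bpSteady_of_le_nineHalves`); for `q > 9/2`
OPEN — the `L^q` sub-problem of the Liouville problem for steady `D`-solutions
(`SteadyDSolutionLiouvilleProblem`, whose normalisation at infinity is the pointwise `U(x) → 0`;
`row_F4bpSteady_of_S1` derives this row from it modulo Galdi's decay theorem X.5.1).  Vacuous
for `q < 1` by the guard. [cite: Galdi2011, §I.2 third open problem and Remark X.9.4 (the D-solution Liouville problem); Thm X.9.5 (q ≤ 9/2)] -/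
@[conjecture] def Row_F4bpSteady (q : ℝ≥0) : Prop :=
  1 ≤ q → ∀ (U : EuclideanSpace ℝ (Fin 3) → EuclideanSpace ℝ (Fin 3))
    (P : EuclideanSpace ℝ (Fin 3) → ℝ),
    IsLerayProfile 1 0 U P → ContDiff ℝ (⊤ : ℕ∞) U → ContDiff ℝ (⊤ : ℕ∞) P →
    (∫⁻ x, ENNReal.ofReal (frobeniusNormSq (fderiv ℝ U x))) < ⊤ →
    MemLp U (q : ℝ≥0∞) volume → U = 0

/-- The steady input is a THEOREM of the tree for `2 ≤ q ≤ 9/2` (Galdi 2011 Thm X.9.5 through the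
Sobolev embedding: `steadyNS_eq_zero_of_memLp_of_dirichlet`). [cite: Galdi2011, Thm X.9.5] -/
theorem row_F4bpSteady_of_le_nineHalves {q : ℝ≥0} (h2q : 2 ≤ q) (hq : (q : ℝ≥0∞) ≤ 9 / 2) :
    Row_F4bpSteady q := by
  intro _ U P hprof _ _ hD hLq
  have h2q' : (2 : ℝ≥0∞) ≤ (q : ℝ≥0∞) := by exact_mod_cast h2q
  exact steadyNS_eq_zero_of_memLp_of_dirichlet one_pos hprof h2q' hq hLq hD

/-! ## The bridge: steady Liouville in `Ḣ¹ ∩ L^p` ⇒ row F4b′ (the non-thin part of Chae's proof) -/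

/-- **Row F4b′ ⇐ the steady Liouville statements `Row_F4bpSteady q`, `q > 9/2`** — the bridge
(census §5 item 10), a theorem.  Given Chae's data at exponent `p > 9/2`: the `L^p` profile `V̄` is
weakly divergence free and a very weak STEADY Navier–Stokes solution
(`typeII_profile_veryWeak_steadyNS`: the Type-II rescalings about `(t₀, 0)` converge to the
constant field `V̄` uniformly on the unit window because `γ > 1`, Chae's `ξ(s)φ(y)` test); a very
weak steady `L^p` solution, `p > 3`, has a smooth steady representative `U`
(`exists_steadyClassicalNS_ae_eq_of_veryWeak`); the weak `L²` gradient of `V̄` is one of `U` and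
agrees a.e. with `∇U`, so `∫ |∇U|²_F < ∞`; `U ∈ L^p`; the hypothesis at `q = p` gives `U = 0`, hence
`V̄ = 0` a.e. [cite: Chae2010, proof of Thm 1.4 (arXiv:0711.1113 §3; journal p. 6 up to the last sentence)] -/
theorem row_F4bp_of_steady (hS : ∀ q : ℝ≥0, (9 / 2 : ℝ≥0∞) < (q : ℝ≥0∞) → Row_F4bpSteady q) :
    Row_F4bp := by
  intro T hT p hp v π hv _hvc γ hγ V hV hconv hH1
  have hp3e : (3 : ℝ≥0∞) < (p : ℝ≥0∞) := lt_trans three_lt_nineHalves_ennreal hp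
  have hp3 : (3 : ℝ≥0) < p := by exact_mod_cast hp3e
  have hp2 : (2 : ℝ≥0) ≤ p := le_trans (by norm_num) hp3.le
  have hp1 : (1 : ℝ≥0) ≤ p := le_trans (by norm_num) hp2
  obtain ⟨hdiv, hsteady⟩ := typeII_profile_veryWeak_steadyNS hT hv hγ hp2 hV hconv
  obtain ⟨U, P, hUP, hVU⟩ := exists_steadyClassicalNS_ae_eq_of_veryWeak hp3 hV hdiv hsteady
  have hprof : IsLerayProfile 1 0 U P := hUP.isLerayProfile_zero
  have hU1 : ContDiff ℝ 1 U := hUP.smooth_velocity.of_le (by norm_cast)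
  have hUp : MemLp U (p : ℝ≥0∞) volume := hV.ae_eq hVU
  obtain ⟨G, hG⟩ := iInf_lt_iff.1 hH1
  obtain ⟨hWG, hGlt⟩ := iInf_lt_iff.1 hG
  have hWGU : HasWeakGradient U G := hWG.congr_ae hVU.symm
  have hDU : HasWeakGradient U (fderiv ℝ U) := hasWeakGradient_fderiv_of_contDiff hU1
  have haeG : fderiv ℝ U =ᵐ[volume] G := by
    have := FunctionSpaces.HasWeakFDerivOn.unique_holds hDU hWGU
    simpa [Measure.restrict_univ] using this
  have hD : (∫⁻ x, ENNReal.ofReal (frobeniusNormSq (fderiv ℝ U x))) < ⊤ := by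
    have e : (∫⁻ x, ENNReal.ofReal (frobeniusNormSq (fderiv ℝ U x))) =
        ∫⁻ x, ENNReal.ofReal (frobeniusNormSq (G x)) := by
      refine lintegral_congr_ae ?_
      filter_upwards [haeG] with x hx
      rw [hx]
    rw [e]; exact hGlt
  have hUs : ContDiff ℝ (⊤ : ℕ∞) U := hUP.smooth_velocity
  have hPs : ContDiff ℝ (⊤ : ℕ∞) P := hUP.smooth_pressure
  have hU0 : U = 0 := hS p hp hp1 U P hprof hUs hPs hD hUp
  rw [hU0] at hVU
  exact hVU

/-! ## Row S1 (pointwise decay normalisation) ⇒ the steady input, modulo Galdi's decay theorem -/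

/-- An `L^q` field on `ℝ³`, `1 ≤ q < ∞`, which tends to a constant at infinity tends to `0`: a
nonzero limit would make `‖U‖ ≥ ‖u₀‖/2` off a compact set, of infinite measure. [folklore] -/
theorem tendsto_cocompact_zero_of_memLp {q : ℝ≥0} (hq : 1 ≤ q)
    {U : EuclideanSpace ℝ (Fin 3) → EuclideanSpace ℝ (Fin 3)} (hU : MemLp U (q : ℝ≥0∞) volume)
    {u₀ : EuclideanSpace ℝ (Fin 3)} (hlim : Tendsto U (cocompact _) (𝓝 u₀)) :
    Tendsto U (cocompact _) (𝓝 0) := by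
  suffices h0 : u₀ = 0 by simpa [h0] using hlim
  by_contra h0
  have hr : 0 < ‖u₀‖ / 2 := by positivity
  -- off a compact set, `‖U x‖ ≥ ‖u₀‖ / 2`
  have hev : ∀ᶠ x in cocompact (EuclideanSpace ℝ (Fin 3)), ‖u₀‖ / 2 ≤ ‖U x‖ := by
    have h1 : ∀ᶠ x in cocompact (EuclideanSpace ℝ (Fin 3)), dist (U x) u₀ < ‖u₀‖ / 2 :=
      Metric.tendsto_nhds.1 hlim _ hr
    filter_upwards [h1] with x hx
    rw [dist_eq_norm] at hx
    have := norm_sub_norm_le u₀ (U x)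
    rw [norm_sub_rev] at this
    linarith
  obtain ⟨K, hK, hKsub⟩ := mem_cocompact.1 hev
  -- the complement of `K` has infinite measure
  have hKc : volume Kᶜ = ⊤ := by
    have huniv : volume (univ : Set (EuclideanSpace ℝ (Fin 3))) = ⊤ :=
      measure_univ_of_isAddLeftInvariant (volume : Measure (EuclideanSpace ℝ (Fin 3)))
    by_contra hfin
    have : volume (univ : Set (EuclideanSpace ℝ (Fin 3))) < ⊤ := by
      rw [← union_compl_self K]
      exact (measure_union_le K Kᶜ).trans_lt
        (ENNReal.add_lt_top.2 ⟨hK.measure_lt_top, lt_top_iff_ne_top.2 hfin⟩)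
    exact absurd huniv this.ne
  -- lower bound for the `L^q` integral on `Kᶜ`
  have hq0 : (q : ℝ≥0∞) ≠ 0 := by
    have : (q : ℝ≥0∞) ≠ 0 := by exact_mod_cast (lt_of_lt_of_le one_pos hq).ne'
    exact this
  have hqtop : (q : ℝ≥0∞) ≠ ⊤ := ENNReal.coe_ne_top
  have hqpos : 0 < (q : ℝ≥0∞).toReal := ENNReal.toReal_pos hq0 hqtop
  have hfin : (∫⁻ x, ‖U x‖ₑ ^ (q : ℝ≥0∞).toReal) < ⊤ :=
    lintegral_rpow_enorm_lt_top_of_eLpNorm_lt_top hq0 hqtop hU.eLpNorm_lt_top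
  have hconst : (∫⁻ _ in Kᶜ, (ENNReal.ofReal (‖u₀‖ / 2)) ^ (q : ℝ≥0∞).toReal) = ⊤ := by
    rw [setLIntegral_const, hKc, ENNReal.mul_top]
    exact (ENNReal.rpow_pos (ENNReal.ofReal_pos.2 hr) ENNReal.ofReal_ne_top).ne'
  have hle : (∫⁻ _ in Kᶜ, (ENNReal.ofReal (‖u₀‖ / 2)) ^ (q : ℝ≥0∞).toReal) ≤
      ∫⁻ x, ‖U x‖ₑ ^ (q : ℝ≥0∞).toReal := by
    refine (setLIntegral_mono' hK.isClosed.measurableSet.compl fun x hx => ?_).trans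
      (setLIntegral_le_lintegral _ _)
    refine ENNReal.rpow_le_rpow ?_ hqpos.le
    rw [← ofReal_norm]
    exact ENNReal.ofReal_le_ofReal (hKsub hx)
  rw [hconst, top_le_iff] at hle
  exact absurd hle hfin.ne

/-- **Row S1 ⇒ the steady input of row F4b′, modulo Galdi's decay theorem** (CONDITIONAL on the
vendored fact `wang2025_rem21_DSolution_tendsto_const` = Galdi 2011 Thm X.5.1, order-zero clause:
a `D`-solution tends to some constant at infinity; no `_holds` in tree).  Given the `D`-solution
Liouville theorem in its pointwise-decay normalisation (`SteadyDSolutionLiouvilleProblem`, census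
row S1) and that fact, every smooth steady solution with finite Dirichlet integral and `U ∈ L^q`,
`1 ≤ q < ∞`, vanishes: it is a `D`-solution, tends to a constant, the constant is `0` because
`U ∈ L^q` (`tendsto_cocompact_zero_of_memLp`), and S1 applies.  With `row_F4bp_of_steady`:
F4b′ ⇐ S1 ∧ (Galdi X.5.1) — the census's "closing F4b′ = row S1 restricted to `Ḣ¹ ∩ L^p`".
[cite: Galdi2011, Thm X.5.1 (decay of D-solutions) and Remark X.9.4] -/
theorem row_F4bpSteady_of_S1 (hS1 : SteadyDSolutionLiouvilleProblem)
    (hdecay : wang2025_rem21_DSolution_tendsto_const) (q : ℝ≥0) : Row_F4bpSteady q := by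
  intro hq U P hprof hUs hPs hD hLq
  -- a Leray profile at rate `a = 0` is a steady solution (the structures agree field by field;
  -- cf. `STH.ParabolicGaldiLiouville.Birth.Tightness.isSteadyNSSolution_of_isLerayProfile_zero`,
  -- not imported: its module lies in the cone of route `GaldiLiouvilleGate`)
  have hst : IsSteadyNSSolution 1 0 U P :=
    { contDiff_velocity := hprof.contDiff_velocity
      contDiff_pressure := hprof.contDiff_pressure
      momentum := fun y => by
        have := hprof.profile_eq y
        simpa only [zero_smul, add_zero, zero_add, Pi.zero_apply] using this
      divFree := hprof.divFree }
  have hDsol : IsDSolution 1 0 U P := ⟨hst, hD⟩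
  obtain ⟨u₀, hu₀⟩ := hdecay U P hDsol
  have h0 : Tendsto U (cocompact _) (𝓝 0) := tendsto_cocompact_zero_of_memLp hq hLq hu₀
  exact hS1 U P hprof hUs hPs hD h0

/-- Assembling: rows S1 (`SteadyDSolutionLiouvilleProblem`) and Galdi's decay theorem give row F4b′
(conditional on the vendored decay fact; S1 itself is OPEN). [cite: Chae2010, Thm 1.4] [cite: Galdi2011, Thm X.5.1] -/
theorem row_F4bp_of_S1 (hS1 : SteadyDSolutionLiouvilleProblem)
    (hdecay : wang2025_rem21_DSolution_tendsto_const) : Row_F4bp :=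
  row_F4bp_of_steady fun q _ => row_F4bpSteady_of_S1 hS1 hdecay q

/-! ## Rows F17, F18, F6e, F8′B, F6sup (appended 2026-08-28; census v1.9/v1.10 keys, ref H13–H17)

Vorticity-direction and endpoint-class criteria, all Literature facts BY NAME (route-independent).
The census-frame forms of the coherence criteria (BKM class discharged from Leray–Hopf + rapid decay)
and row F1b′ live in `ScenarioCensusForwardFrames.lean` (route cones).  Cited only (theorems of the
tree without a `Prop` name, too long to restate here): F18 (b) `holderHalf_direction_criterion`,
`holder_direction_criterion`, `…_of_late`, `constantin_fefferman_of_late`; (c)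
`holderWeight_direction_criterion(_LaLb/_LaLinfty)`, `holderWeight_direction_vorticityLp_criterion`;
(d) `holder_direction_vorticityLp/LqL2/LqLp_criterion`; 𝕋³ `Torus.classicalNS_continuation_of_*`. -/

/-- **Row F17** (I∨II · no symmetry · local suitable weak solution in `Q(1)` · vorticity direction
in a DOUBLE CONE `{|ξ × e| ≤ 1 − δ}` wherever `|ω| > M` at regular points ⇒ regular on the closed
`Q(1/2)`) — BY NAME the typed fact `LeiRenTian2025_doubleCone_regularity` (Lei–Ren–Tian 2025,
arXiv:2501.08976 Thm 1.1; preprint), NO `_holds` in tree.  Value: EXCLUDED-IN-PRINT-NOT-TREE; its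
rotated-DSS corollary is row D7d. (ref: LeiRenTian2025, Thm 1.1 p. 4) -/
def Row_F17 : Prop := LeiRenTian2025_doubleCone_regularity

/-- **Row F18 (a)** (I∨II · none · classical on `[0,T)` in the BKM class on closed sub-slabs ·
Constantin–Fefferman 1993: `sin∠(ξ(x),ξ(y)) ≤ |x−y|/ρ` on `{|ω| > Ω}` ⇒ continuation in the class):
ALIAS of the fact `constantin_fefferman`, PROVED (`constantin_fefferman_holds`).  Census-frame form
(BKM class discharged): `Row_F18cf` in `ScenarioCensusForwardFrames.lean`.  EXCLUDED-IN-TREE.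
(ref: ConstantinFefferman1993, Thm; LemarieRieusset2016, Thm 11.6) -/
def Row_F18a : Prop := constantin_fefferman

/-- Row F18 (a) is a theorem of the tree. [cite: ConstantinFefferman1993, Theorem] -/
theorem row_F18a_excluded : Row_F18a := constantin_fefferman_holds

/-- **Row F18 (d)** (hybrid geometric criterion of Grujić–Ružmaikina 2004 Thm 4.1: Hölder coherence
of the vorticity direction traded against vorticity integrability) — ALIAS of the fact
`grujicRuzmaikina2004_hybrid_direction_criterion`, PROVED.  EXCLUDED-IN-TREE (criterion).
(ref: GrujicRuzmaikina2004, Thm 4.1) -/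
def Row_F18d : Prop := grujicRuzmaikina2004_hybrid_direction_criterion

/-- Row F18 (d) is a theorem of the tree. [cite: GrujicRuzmaikina2004, Thm 4.1] -/
theorem row_F18d_excluded : Row_F18d := grujicRuzmaikina2004_hybrid_direction_criterion_holds

/-- **Row F18 (e)** (LOCALIZED coherence criteria on backward cylinders: Grujić–Zhang 2006 Thms
1.1/1.2 hybrid and integral forms, Grujić 2009 Thm 1 local ½-Hölder coherence, Grujić–Guberović 2010
weighted coherence) — ALIAS of the conjunction of the four facts, all PROVED.  EXCLUDED-IN-TREE
(criteria). (ref: GrujicZhang2006, Thms 1.1–1.2; Grujic2009, Thm 1; GrujicGuberovic2010, Thm 1) -/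
def Row_F18e : Prop :=
  grujicZhang2006_localized_hybrid_coherence ∧ grujicZhang2006_localized_integral_coherence ∧
    grujic2009_localized_halfHolder_coherence ∧ grujicGuberovic2010_coherenceWeighted_criterion

/-- Row F18 (e) is a theorem of the tree (four discharges). [cite: GrujicZhang2006, Thms 1.1–1.2] -/
theorem row_F18e_excluded : Row_F18e :=
  ⟨grujicZhang2006_localized_hybrid_coherence_holds, grujicZhang2006_localized_integral_coherence_holds,
    grujic2009_localized_halfHolder_coherence_holds, grujicGuberovic2010_coherenceWeighted_criterion_holds⟩

/-- **Row F6e** (I∨II · none · reduced-quantity critical mixed classes, census frame: `∇u ∈ L^q_t L^r_x`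
with `2/q + 3/r = 2`; one directional derivative `∂₃u`; the gradient of one component `∇u₃`; the
pressure gradient `∇p ∈ L^s_t L^q_x`, `2/s + 3/q = 3` — Beirão da Veiga 1995 and descendants) — ALIAS of
the conjunction of the four typed facts `BeiraoDaVeiga1995_gradientCriterion`,
`oneDirectionDerivativeCriterion`, `oneComponentGradientCriterion`, `pressureGradientCriterion`, all
PROVED (the vorticity form is `Row_F6eV`; the `u₃`-only print criteria of the census cell have no
`_holds`).  EXCLUDED-IN-TREE (criteria). (ref: BeiraoDaVeiga1995; see the four facts' docstrings) -/
def Row_F6e : Prop :=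
  BeiraoDaVeiga1995_gradientCriterion ∧ oneDirectionDerivativeCriterion ∧
    oneComponentGradientCriterion ∧ pressureGradientCriterion

/-- Row F6e is a theorem of the tree (four discharges). [cite: BeiraoDaVeiga1995, Thm (gradient form)] -/
theorem row_F6e_excluded : Row_F6e :=
  ⟨BeiraoDaVeiga1995_gradientCriterion_holds, oneDirectionDerivativeCriterion_holds,
    oneComponentGradientCriterion_holds, pressureGradientCriterion_holds⟩

/-- **Row F6e, vorticity form** (census frame · `ω = curl u ∈ L^q(0,T; L^r)`, `2/q + 3/r = 2`,
`1 < q < ∞` ⇒ extension past `T`): the statement of the tree theorem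
`BeiraoDaVeiga1995_vorticityCriterion` verbatim (Beirão da Veiga 1995 as restated by Chae; the
endpoint `r = ∞` is BKM and is not part of it).  EXCLUDED-IN-TREE. (ref: Chae2007RMI, (1.8); BeiraoDaVeiga1995) -/
def Row_F6eV : Prop :=
  ∀ (ν T : ℝ), 0 < ν → 0 < T →
    ∀ (u : ℝ → EuclideanSpace ℝ (Fin 3) → EuclideanSpace ℝ (Fin 3))
      (p : ℝ → EuclideanSpace ℝ (Fin 3) → ℝ),
    IsClassicalNSSolutionOn (Ico 0 T) ν 0 u p → IsLerayHopfOn T ν 0 (u 0) u →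
    HasRapidSpatialDecay (u 0) →
    ∀ (q r : ℝ≥0∞), 1 < q → q < ⊤ → 2 / q + 3 / r = 2 →
      MemLqLp q r (fun t x => curl (u t) x) (Ioo 0 T) → HasSmoothExtensionPast ν 0 u T

/-- Row F6e (vorticity form) is a theorem of the tree. [cite: Chae2007RMI, (1.8) p. 372] -/
theorem row_F6eV_excluded : Row_F6eV := BeiraoDaVeiga1995_vorticityCriterion

/-- **Row F8′B** (I∨II · none · census frame ∩ `L^∞_t Ḃ^{−1+3/r}_{r,q}`, `3 < r, q < ∞`, slices
represented by tempered distributions): extension past `T` — ALIAS of the fact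
`hasSmoothExtensionPast_of_eHomBesovNorm_bounded` (Gallagher–Koch–Planchon 2016 Thm 1), PROVED in tree
(`…_holds`, via Wang–Zhang 2017 blow-up/rigidity; refuter finding H17).  EXCLUDED-IN-TREE — the Besov
half of census row F8′ (the Lorentz `L^{3,q}` half stays print-only).
(ref: GallagherKochPlanchon2016, Thm 1) -/
def Row_F8pB : Prop := hasSmoothExtensionPast_of_eHomBesovNorm_bounded

/-- Row F8′B is a theorem of the tree. [cite: GKP2016, Thm. 1] -/
theorem row_F8pB_excluded : Row_F8pB := hasSmoothExtensionPast_of_eHomBesovNorm_bounded_holds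

/-- **Row F6sup** (I∨II · none · census frame ∩ `L^∞_t L³_x` up to `T`: `sup_{0≤t<T} ‖u(t)‖₃ < ∞` ⇒
extension past `T`) — the `HasSmoothExtensionPast` form of row F6 (ESS 2003 Thm 1.4 / Seregin 2012
Thm 1.1) in the census frame: ALIAS of `hasSmoothExtensionPast_of_eLpNorm_three_bounded`, PROVED
(`…_holds`).  EXCLUDED-IN-TREE. (ref: Seregin2012, Thm 1.1; EscauriazaSereginSverak2003, Thm 1.4) -/
def Row_F6sup : Prop := hasSmoothExtensionPast_of_eLpNorm_three_bounded

/-- Row F6sup is a theorem of the tree. [cite: Seregin2012, Thm. 1.1] -/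
theorem row_F6sup_excluded : Row_F6sup := hasSmoothExtensionPast_of_eLpNorm_three_bounded_holds

end Summit.NavierStokesRegularity.NavierStokesRegularity.Theorems.ScenarioCensus

end
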